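import Literature.MathematicalPhysics.QuantumFieldTheory.Balaban1983to89.B3Op116CollarRows
import Literature.MathematicalPhysics.QuantumFieldTheory.Balaban1983to89.B3Op116LeibnizRows
import Literature.MathematicalPhysics.QuantumFieldTheory.Balaban1983to89.B3Ineq210RegularRegion
import Literature.MathematicalPhysics.QuantumFieldTheory.Balaban1983to89.B1Cor23ZeroFieldRegion

/-!
# Bałaban, *(Higgs)₂,₃ quantum fields in a finite volume III* [B3] — the class-(c) CONFIGURATION GEOMETRY for the collar operator
(Route δ): the far/near hypotheses from one support condition — file «CollarConfig»

statement-level skeleton of published theorems with citation tags; proofs where landed; nothing here is a claim about the Yang–Mills mass gap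

T. Bałaban, Commun. Math. Phys. **88** (1983) 411–445 [cite: Balaban1983Higgs3], p. 433 [PDF 23], class (c) — verbatim: *"there exists a
constant field B̃₀ such that |B̃ − B̃₀| ≤ O(r(L^kε)p(L^kε)) ≤ O(p(L^kε)²) on the cube □. We have B̃ = B̃₀ + B̃′, and we expand in B̃′"*; the
SUPPORT CONDITION below is NOT print's: it is the cell's Route δ (HOME/GAPS.md G-B3-16.A1, a recorded proof-route deviation from p. 433
l.12–15), which splits `B̃′ = B̃′χ + P` and carries the collar part `P := B̃′(1−χ)` — supported away from the localization region — unexpanded.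
Part I [cite: Balaban1982Higgs1], (1.3) p. 604 (the lattice distance), (1.20) p. 607.

CITATION HEADER (lean-in-tree rule).  Cell `lit-balaban`, Phase-2 proof seat **p40** gen 77 (unit `lit-balaban-p40`); free-target protocol
G.5-34(d), TAKING line HOME/STATUS.md 2026-08-23T12:41:06Z (cc r15 = owner of rows B3.Txt@433 / B3.Eq1.16 / B3.Eq2.5, p35).  Design note
`lit-balaban-p40/DESIGN-B3-116-box.md` §8.3 item 2 (the configuration plug).  USED BY NAME: p40's `B3Op116CollarRows.Far` (p365561),
p35's `B3Op116LeibnizRows.{pred, pred_tgt}`, r14's `B3Ineq210RegularRegion.Interior`, `B1Cor23ZeroFieldRegion.tdist_le_of_blockIter_eq_real`,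
`B1Ineq234LevelZero.{tdist_triangle_real, tdist_comm, tdist_shift_le_one}`.  No head claim.

## What this file proves

From ONE support condition on the perturbation `P` (= print's `B̃′`), relative to the interior points of the localization region `Ω₂`:
`(S_R)  ∀ b, P(b) ≠ 0 → ∀ x, Interior_k(Ω₂) x → R ≤ |x − b₋|` (lattice units), with `ρL^k + L^k ≤ R`:
* `farI_of_supp` — the hypothesis `hfarI` of p40's members (`B3Ineq25Op116CollarRegion.ineq25At_one_zero_collar_of_dict` /`…collarBox`, and the
  Hölder members): every `k`-block-mate `z` of a charged source is `Far(ρ)` from every interior `x`, in both orders;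
* `farC_of_supp` — the hypothesis `hfarC` of the Hölder members: both endpoints of every charged or pred-charged bond are `Far(ρ)` from interior points;
* `nearP_of_supp` — the hypothesis `hnearP`: if moreover `dL^k < R`, `P` vanishes on the bonds from the ball `B(x, dL^k)` around an interior `x`.

## Honest scope

Pure lattice geometry (triangle inequality for (1.3), block diameter `≤ L^k − 1`, `|x − (x+e_μ)| ≤ 1`).  The support condition is the
cell's Route δ condition on the collar part `P` (not a printed sentence); here it is phrased relative to the INTERIOR POINTS of `Ω₂` (the points
at which (2.5) is asserted by the members), which is what the members consume; relating `R` to the cutoff `χ` and to the box is the caller's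
bookkeeping.  Theorems only; no `sorry`; axioms
standard.  Value = a located member of a by-reference step of B3 — NOT summit progress and nothing about the Yang–Mills mass gap.
-/

noncomputable section

namespace Literature.MathematicalPhysics.QuantumFieldTheory.Balaban1983to89.B3Op116CollarConfig

open HiggsAveraging (blockIter)
open B3Op116CollarRows (Far)
open B3Op116LeibnizRows (pred pred_tgt)
open B3Ineq210RegularRegion (Interior)
open B1Cor23ZeroFieldRegion (tdist_le_of_blockIter_eq_real)
open B1Ineq234LevelZero (tdist_triangle_real tdist_comm tdist_shift_le_one)

variable {P : HiggsLattice.Params}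

/-- `Far(ρ)` from a lattice-unit lower bound: `ρL^k ≤ |x − y| ⇒ L^kε·ρ ≤ ε|x − y|`. [cite: Balaban1982Higgs1, (1.3) p.604] -/
theorem far_of_le {k : ℕ} {ρ : ℝ} {x y : HiggsLattice.Site P 0} (h : ρ * (P.L : ℝ) ^ k ≤ (HiggsLattice.Site.tdist x y : ℝ)) :
    Far P k ρ x y := by
  unfold Far
  have hm : P.mesh k = (P.L : ℝ) ^ k * P.mesh 0 := by
    have h := B3Op116CollarRows.mesh_eq_pow_mul_mesh (P := P) (Nat.zero_le k); rwa [Nat.sub_zero] at h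
  rw [hm]
  have hε := P.mesh_pos 0
  nlinarith

/-- `Far` is symmetric. [cite: Balaban1982Higgs1, (1.3) p.604] -/
theorem far_comm {k : ℕ} {ρ : ℝ} {x y : HiggsLattice.Site P 0} (h : Far P k ρ x y) : Far P k ρ y x := by
  unfold Far at h ⊢; rwa [tdist_comm]

/-- a point at distance `≥ R` from `x` stays at distance `≥ R − t` after moving by `≤ t`. [cite: Balaban1982Higgs1, (1.3) p.604] -/
theorem tdist_ge_sub {x s z : HiggsLattice.Site P 0} {R t : ℝ} (hR : R ≤ (HiggsLattice.Site.tdist x s : ℝ))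
    (ht : (HiggsLattice.Site.tdist s z : ℝ) ≤ t) : R - t ≤ (HiggsLattice.Site.tdist x z : ℝ) := by
  have h := tdist_triangle_real x z s
  rw [tdist_comm z s] at h
  linarith

section Supp

variable {k K₀ : ℕ} {Ω₂ : Finset (HiggsLattice.Site P 0)} {Pf : HiggsLattice.VecField P 0} {ρ R : ℝ}

/-- **`hfarI` from the support condition**: `(S_R)` with `ρL^k + L^k ≤ R` ⇒ every `k`-block-mate of a charged source is `Far(ρ)` from every
interior point, in both orders (`k ≤ K_P`). [cite: Balaban1983Higgs3, p.433] [cite: Balaban1982Higgs1, (1.20) p.607] -/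
theorem farI_of_supp (hk : k ≤ P.K) (hR : ρ * (P.L : ℝ) ^ k + (P.L : ℝ) ^ k ≤ R)
    (hsupp : ∀ b : HiggsLattice.PBond P 0, Pf b ≠ 0 → ∀ x : HiggsLattice.Site P 0, Interior k K₀ Ω₂ x →
      R ≤ (HiggsLattice.Site.tdist x b.src : ℝ)) :
    ∀ x x' : HiggsLattice.Site P 0, Interior k K₀ Ω₂ x → Interior k K₀ Ω₂ x' →
      ∀ b : HiggsLattice.PBond P 0, Pf b ≠ 0 → ∀ z : HiggsLattice.Site P 0, blockIter k z = blockIter k b.src →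
        Far P k ρ x z ∧ Far P k ρ z x' := by
  intro x x' hx hx' b hb z hz
  have hzs : (HiggsLattice.Site.tdist b.src z : ℝ) ≤ (P.L : ℝ) ^ k - 1 := by
    rw [tdist_comm]; exact tdist_le_of_blockIter_eq_real hk hz
  refine ⟨far_of_le ?_, far_comm (far_of_le ?_)⟩
  · have := tdist_ge_sub (hsupp b hb x hx) hzs; linarith
  · have := tdist_ge_sub (hsupp b hb x' hx') hzs; linarith

/-- **`hfarC` from the support condition**: `(S_R)` with `ρL^k + L^k ≤ R` and `k ≥ 1`, `L ≥ 2` ⇒ both endpoints of every charged bond and of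
every bond whose predecessor is charged are `Far(ρ)` from every interior point. [cite: Balaban1983Higgs3, p.433] [cite: Balaban1982Higgs1, (1.3) p.604] -/
theorem farC_of_supp (hL2 : 2 ≤ P.L) (hk1 : 1 ≤ k) (hR : ρ * (P.L : ℝ) ^ k + (P.L : ℝ) ^ k ≤ R)
    (hsupp : ∀ b : HiggsLattice.PBond P 0, Pf b ≠ 0 → ∀ x : HiggsLattice.Site P 0, Interior k K₀ Ω₂ x →
      R ≤ (HiggsLattice.Site.tdist x b.src : ℝ)) :
    ∀ x x' : HiggsLattice.Site P 0, Interior k K₀ Ω₂ x → Interior k K₀ Ω₂ x' →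
      ∀ b : HiggsLattice.PBond P 0, (Pf b ≠ 0 ∨ Pf (pred b) ≠ 0) →
        (Far P k ρ x b.src ∧ Far P k ρ b.src x') ∧ (Far P k ρ x b.tgt ∧ Far P k ρ b.tgt x') := by
  intro x x' hx hx' b hb
  have hL2k : (2 : ℝ) ≤ (P.L : ℝ) ^ k := by
    have h2 : (2 : ℝ) ≤ (P.L : ℝ) := by exact_mod_cast hL2
    calc (2 : ℝ) ≤ (P.L : ℝ) := h2
      _ = (P.L : ℝ) ^ 1 := (pow_one _).symm
      _ ≤ (P.L : ℝ) ^ k := pow_le_pow_right₀ (by linarith) hk1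
  have ht1 : (HiggsLattice.Site.tdist b.src b.tgt : ℝ) ≤ 1 := by exact_mod_cast tdist_shift_le_one b.src b.dir
  -- a lower bound `ρL^k + 2 ≤ |x − b₋|` at every interior point suffices for both endpoints
  have key : ∀ y : HiggsLattice.Site P 0, Interior k K₀ Ω₂ y → ρ * (P.L : ℝ) ^ k + 1 ≤ (HiggsLattice.Site.tdist y b.src : ℝ) := by
    intro y hy
    rcases hb with hb | hb
    · have := hsupp b hb y hy; linarith
    · have h0 := hsupp (pred b) hb y hy
      have hps : (HiggsLattice.Site.tdist (pred b).src b.src : ℝ) ≤ 1 := by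
        rw [← pred_tgt b]; exact_mod_cast tdist_shift_le_one (pred b).src (pred b).dir
      have := tdist_ge_sub h0 hps; linarith
  refine ⟨⟨far_of_le (by linarith [key x hx]), far_comm (far_of_le (by linarith [key x' hx']))⟩,
    ⟨far_of_le ?_, far_comm (far_of_le ?_)⟩⟩
  · have := tdist_ge_sub (key x hx) ht1; linarith
  · have := tdist_ge_sub (key x' hx') ht1; linarith

/-- **`hnearP` from the support condition**: `(S_R)` with `dL^k < R` ⇒ `P` vanishes on every bond from the ball `B(x, dL^k)` around an interior
point `x`. [cite: Balaban1983Higgs3, p.433] [cite: Balaban1982Higgs1, (1.3) p.604] -/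
theorem nearP_of_supp (hR : (P.d : ℝ) * (P.L : ℝ) ^ k < R)
    (hsupp : ∀ b : HiggsLattice.PBond P 0, Pf b ≠ 0 → ∀ x : HiggsLattice.Site P 0, Interior k K₀ Ω₂ x →
      R ≤ (HiggsLattice.Site.tdist x b.src : ℝ)) :
    ∀ x : HiggsLattice.Site P 0, Interior k K₀ Ω₂ x →
      ∀ z : HiggsLattice.Site P 0, (HiggsLattice.Site.tdist x z : ℝ) ≤ (P.d : ℝ) * (P.L : ℝ) ^ k → ∀ ν : Fin P.d, Pf ⟨z, ν⟩ = 0 := by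
  intro x hx z hz ν
  by_contra hne
  have := hsupp ⟨z, ν⟩ hne x hx
  simp only at this
  linarith

end Supp

end Literature.MathematicalPhysics.QuantumFieldTheory.Balaban1983to89.B3Op116CollarConfig

end
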